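import Summits.CriticalPhenomena.PercolationContinuityZ3.Theorems.Transplant.SkelFrmBChoiceAtQ
import Summits.CriticalPhenomena.PercolationContinuityZ3.Theorems.Transplant.SkelPhiCylBall
import HarnessLib

/-!
# N2 (frames-only node `SamePDropOfSkeletonFrm₁`, OPEN), WAVE 1: THE ZONE FACTS AT `AtQNQ` OF THE CHOICES OF RECORD — `hzconn_of_atQ`, `hkz_of_atQ`
# (the (R-35) kit clause's kept zone rows at `Λc c kz := O.merged.Λ c (Mu O.merged)`, `kz := Mu O.merged`)

After (R-35) (re-centring at `ctColEnd`; `kitClauseFC` binder list p1-g17 2026-08-23T03:18:28Z) the zone-datum rows the residues keep are `hΛRg` (stmt `hΛRg_of_atQ`, ChoiceKit),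
`hzconn`, `hcz`, `hRgcard/hcU1/hRg` (KitS).  The long links in the literal kit shape are p3-g16's `SkelFrmBChoiceLinks` p351172 (`hlong_of_atQ3/hlongY_of_atQ3`, file of record
per lead g11 03:33:51Z — NOT restated here).  This file serves the two zone facts that come from the record alone: the `M_u`-zone `Λ c M_u = fatSeq c M_u = cylBall c M_u ψ(M_u)`
(`FactsO.seed`) is connected from its centre INSIDE ITSELF (`Skelφ.pathIn_cylBall`), and `1 ≤ M_u` (`1 ≤ k ≤ M₀ ≤ M_u`).  `hcz : c ∈ Λ c M_u` waits for a `self_mem_cylBall` lemma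
(kit side, on demand).
* **`hzconn_of_atQ`**, `hkz_of_atQ`.
builds on p205010 (kernel theorem, internal audit signed; external expert review pending) — nothing in this file uses p205010; NOTHING is claimed about the open node
`SamePDropOfSkeletonFrm₁` (`SamePDropOfSkeletonNeg₁` is CLOSED in the tree and untouched by this file).
Lane `prim-bschramm`, seat `prim-bschramm-stmt` (gen 20); helper file (`--supports stmt-CriticalPhenomena-4575 --as helper`); ruling (R-35), lead g11 03:33:51Z (trim).
[cite: KozmaNitzan2024, §4 p. 16 (Lemma 9: the fat prisms), p. 19 (the wired cube)] [cite: MartineauTassion2017, §3.2 Lemma 3.5]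
-/

noncomputable section

open scoped Classical

namespace Summit.CriticalPhenomena.PercolationContinuityZ3.Theorems.Transplant

open MeasureTheory Literature.Probability.Percolation Literature.Probability.LatticeModels SimpleGraph KNCells

namespace PlanarSkeletonFrm

open SkelConc (Consts)
open Skelφ (oriφ trφ)
open Skelφ.StepI (DataN DataNS OutNS)

namespace NegB

open Neg

section AtQ

variable {κ : Consts} {V : Type} [DecidableEq V] [Countable V] {G : SimpleGraph V} [G.LocallyFinite] {Φ : PlanarSkeletonFrm G} {t : V} {p : unitInterval}
  {hC : Φ.CylSubcritical p} {gv fv : Neg.FSlot} {Pv : PSlot} {Sv : SSlot} {cv : CSlot} {bv : BSlot} {O : OutNS V} {q : unitInterval}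

/-- **`hzconn`**: the `M_u`-zone is connected from its centre INSIDE ITSELF — `Λ c M_u = fatSeq c M_u = cylBall c M_u (fatRadius M_u)` and `pathIn_cylBall`. [folklore] -/
theorem hzconn_of_atQ (hAt : (choiceAtQ3 κ Φ t p Pv gv fv Sv cv bv hC).AtQNQ O q) :
    ∀ c, ∀ s ∈ O.merged.Λ c (Mu O.merged), PathIn G (↑(O.merged.Λ c (Mu O.merged)) : Set V) c s := by
  intro c s hs
  obtain ⟨-, -, -, -, hΛeq⟩ := Skelφ.StepI.OutO.FactsO.seed hAt.1.factsO
  have e : O.merged.Λ c (Mu O.merged) = Skelφ.fatSeq Φ.frame hC c (Mu O.merged) := congrFun (congrFun hΛeq c) _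
  have eset : (↑(O.merged.Λ c (Mu O.merged)) : Set V) = Skelφ.cylBall G Φ.φ c (Mu O.merged) (Skelφ.fatRadius Φ.frame hC (Mu O.merged)) := by
    ext v; rw [Finset.mem_coe, e, Skelφ.mem_fatSeq_iff]
  rw [eset]
  have hs' : s ∈ Skelφ.cylBall G Φ.φ c (Mu O.merged) (Skelφ.fatRadius Φ.frame hC (Mu O.merged)) := by
    rw [e, Skelφ.mem_fatSeq_iff] at hs; exact hs
  exact Skelφ.pathIn_cylBall (G := G) (φ := Φ.φ) hs'

omit [DecidableEq V] in
/-- **`hkz`** at `kz := M_u`: `1 ≤ M_u` (`1 ≤ k ≤ M₀ ≤ M_u`). [folklore] -/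
theorem hkz_of_atQ [DecidableEq V] (hAt : (choiceAtQ3 κ Φ t p Pv gv fv Sv cv bv hC).AtQNQ O q) : 1 ≤ Mu O.merged := by
  obtain ⟨-, h1k, hkM, -, -⟩ := Skelφ.StepI.OutO.FactsO.seed hAt.1.factsO
  exact le_trans h1k (le_trans hkM (M₀_le_Mu O.merged))

/-- **`hcz`**: every centre lies in its own `M_u`-zone — `Λ c M_u = fatSeq c M_u ∋ c` (`self_mem_cylBall`); two-liner of p1-g17 (INBOX 2026-08-23T04:26:26Z,
farm-checked there), landed here with the other zone rows. [folklore] -/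
theorem hcz_of_atQ (hAt : (choiceAtQ3 κ Φ t p Pv gv fv Sv cv bv hC).AtQNQ O q) (c : V) : c ∈ O.merged.Λ c (Mu O.merged) := by
  obtain ⟨-, -, -, -, hΛeq⟩ := Skelφ.StepI.OutO.FactsO.seed hAt.1.factsO
  have hΛ : O.merged.Λ c (Mu O.merged) = Skelφ.fatSeq Φ.frame hC c (Mu O.merged) := congrFun (congrFun hΛeq c) (Mu O.merged)
  rw [hΛ, Skelφ.mem_fatSeq_iff]
  exact Skelφ.self_mem_cylBall G Φ.φ c _ _

/-- **`hcz` at every level**: `c ∈ Λ c k` for all `k` (`Λ = fatSeq` at every level by `FactsO.seed`). [folklore] -/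
theorem hczAt_of_atQ (hAt : (choiceAtQ3 κ Φ t p Pv gv fv Sv cv bv hC).AtQNQ O q) (c : V) (k : ℕ) : c ∈ O.merged.Λ c k := by
  obtain ⟨-, -, -, -, hΛeq⟩ := Skelφ.StepI.OutO.FactsO.seed hAt.1.factsO
  have hΛ : O.merged.Λ c k = Skelφ.fatSeq Φ.frame hC c k := congrFun (congrFun hΛeq c) k
  rw [hΛ, Skelφ.mem_fatSeq_iff]
  exact Skelφ.self_mem_cylBall G Φ.φ c _ _

end AtQ

end NegB

end PlanarSkeletonFrm

end Summit.CriticalPhenomena.PercolationContinuityZ3.Theorems.Transplant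

end
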